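import Mathlib
import HarnessLib
import Literature.MathematicalPhysics.QuantumLattice.GrassmannDefectSplit
import Summits.HubbardSuperconductivity.HubbardSuperconductivity.Theorems.KLProgrammeKLRegimeTwoVolumeLipDoubledDefs
import Summits.HubbardSuperconductivity.HubbardSuperconductivity.Theorems.KLProgrammeKLRegimeTwoVolumeSourceReadoutAt

/-!
# Route `KLProgramme` — crux K3 ENGINE (stmt-HubbardSuperconductivity-20437), stub (e) proof-input «(e)-D-ROWS», keying (A′), REKEY-D file D11a:
# THE PLAIN READ-OUT OF THE DOUBLED TOWER — all-plain strings of `klLipInputD` and of the two-volume difference `klLipInputDiffD` read the RAW position kernels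
# (seat hubbard-kl-k3c4-p1 g27; REKEY-D.md §2 «Read-out⁺»: the copy-`1` kernels of the doubled input at the top block are `ε^m ×` the raw kernels `hdualSp` reads)

* **`kernel_klLipInputD_src`** — `kernel (klLipInputD V … d k) m X = ε^m · W^{V}_m[𝒱_{dk}](plain string of X)` for `X` all in copy `1`, sector slot `0` (`kernel_klLipInputD` ∘ k3c5-p3's
  `kernel_klSrcActionAt_src`; independent of the alive family);
* `klBlockEquivD_snd_eq` — the doubled block structure keeps copy and sector label, residue position `(x₀, x⃗ mod L)`;
* **`kernel_klLipInputDiffD_src`** — the all-plain strings of the doubled two-volume input difference read `ε^m·W^{bL}_m(X) − [all legs of X in one block]·ε^m·W^{L}_m(residues of X)`: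
  the raw two-volume kernel difference of `𝒱_{dk}` at the common frame in the glue reading — at `m = 2` and the top block this is, up to the counterterm seam `𝒩^{bL}_K − glue 𝒩^{L}_K`
  (finite range, zero at deep pins) and the far rows, the common-frame pinned defect `Pc` of ✓ `TwoVolumeDefect.hPd_of_commonFrame_add_conversion` (D11 proper).

Identities only; nothing asserts the (D) rows, (e), VL, K3 or superconductivity.  References: BGM 2006 §2.9 (4.3)–(4.6) [cite: BenfattoGiulianiMastropietro2006].
-/

noncomputable section

namespace Summit.HubbardSuperconductivity.HubbardSuperconductivity.Theorems.TwoVolumeLip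

set_option linter.dupNamespace false -- summit = problem name (single-conjunct summit), D-0017

open Finset Literature.MathematicalPhysics.QuantumLattice GrassmannAlgebra Literature.Probability.LatticeModels
open Literature.MathematicalPhysics.QuantumLattice.FermiRG
open Summit.HubbardSuperconductivity.HubbardSuperconductivity.Theorems.KLRegimeSplit
open Summit.HubbardSuperconductivity.HubbardSuperconductivity.Theorems.KLProgrammeLegKernels
open Summit.HubbardSuperconductivity.HubbardSuperconductivity.Theorems.EngineV8
open Summit.HubbardSuperconductivity.HubbardSuperconductivity.Theorems.TwoVolumeSource
open Summit.HubbardSuperconductivity.HubbardSuperconductivity.Theorems.TwoVolumeDefect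

/-! ## D11a THE PLAIN READ-OUT OF THE DOUBLED TOWER: all-plain strings of `klLipInputD` / `klGlueD` / `klLipInputDiffD` read the RAW position kernels -/

section ReadoutD

variable {V M : ℕ} [NeZero V]

/-- **All-plain (copy `1`, slot `0`) strings of the doubled input read `ε^m ×` the RAW position-space kernels of `𝒱_{dk}`** — independently of the alive family
(`kernel_klLipInputD` ∘ k3c5-p3's `kernel_klSrcActionAt_src`).  At `m = 2` this is the object `hdualSp` reads. [cite: BenfattoGiulianiMastropietro2006, §2.9 (4.3)-(4.6)] -/
theorem kernel_klLipInputD_src (β U μ : ℝ) (K : TrigPolyC4v) (d k m : ℕ) (X : Fin m → SrcLabel V M (d * k - 1))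
    (hX : ∀ i, (X i).2 = 1) (h0 : ∀ i, ((X i).1.2.1.1 : ℕ) = 0) :
    kernel ℂ (klLipInputD V M β U μ K d k) m X =
      (((imagTimeWeight β M : ℝ) : ℂ)) ^ m * sectorisedKernel V M β (trivialMultiplier V M) (klTowerInput V M β U μ K d k) m
        (fun i => ((((0 : Fin 1), (X i).1.2.1.2), (X i).1.2.2) : SectorLeg 1)) (fun i => (X i).1.1) := by
  rw [kernel_klLipInputD, kernel_klSrcActionAt_src β U μ K _ _ m X hX h0]
  rfl

variable {L b : ℕ} [NeZero L] [NeZero (b * L)] [NeZero M]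

omit [NeZero M] in
/-- The doubled block structure preserves the copy and the sector label of a leg; its residue position is `(x₀, x⃗ mod L)`. -/
theorem klBlockEquivD_snd_eq (n : ℕ) (X' : SrcLabel (b * L) M n) :
    (klBlockEquivD L b M n X').2 = (((X'.1.1.1, fun i => (((X'.1.1.2 i).val : ℕ) : ZMod L)), X'.1.2), X'.2) := by
  obtain ⟨x, s⟩ := X'
  rw [klBlockEquivD_apply, klBlockEquiv_snd]

/-- **All-plain strings of the doubled two-volume INPUT DIFFERENCE**: at labels all in copy `1`, slot `0`, pinned slot `j`,
`kernel (klLipInputDiffD … d k) m X = ε^m·W^{bL}_m(plain string at the positions of X) − [all X_i in the block of X_j]·ε^m·W^{L}_m(plain string at the residues)` —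
the raw two-volume kernel difference of `𝒱_{dk}` in the glue reading (`W^V_m = sectorisedKernel V … (trivialMultiplier) 𝒱^{V}_{dk}`). [cite: BenfattoGiulianiMastropietro2006, §2.9 (4.3)-(4.6)] -/
theorem kernel_klLipInputDiffD_src (β U μ : ℝ) (K : TrigPolyC4v) (d k m : ℕ) (j : Fin m) (X : Fin m → SrcLabel (b * L) M (d * k - 1))
    (hX : ∀ i, (X i).2 = 1) (h0 : ∀ i, ((X i).1.2.1.1 : ℕ) = 0) :
    kernel ℂ (klLipInputDiffD L b M β U μ K d k) m X =
      (((imagTimeWeight β M : ℝ) : ℂ)) ^ m * sectorisedKernel (b * L) M β (trivialMultiplier (b * L) M) (klTowerInput (b * L) M β U μ K d k) m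
          (fun i => ((((0 : Fin 1), (X i).1.2.1.2), (X i).1.2.2) : SectorLeg 1)) (fun i => (X i).1.1) -
        (if ∀ i, (klBlockEquivD L b M (d * k - 1) (X i)).1 = (klBlockEquivD L b M (d * k - 1) (X j)).1 then
          (((imagTimeWeight β M : ℝ) : ℂ)) ^ m * sectorisedKernel L M β (trivialMultiplier L M) (klTowerInput L M β U μ K d k) m
            (fun i => ((((0 : Fin 1), (X i).1.2.1.2), (X i).1.2.2) : SectorLeg 1))
            (fun i => ((X i).1.1.1, fun l => ((((X i).1.1.2 l).val : ℕ) : ZMod L)))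
        else 0) := by
  rw [klLipInputDiffD_def, kernel_sub', kernel_klLipInputD_src β U μ K d k m X hX h0, kernel_klGlueD _ j]
  congr 1
  split_ifs with hblk
  · rw [kernel_klLipInputD_src β U μ K d k m _ (fun i => by rw [klBlockEquivD_snd_eq]; exact hX i)
      (fun i => by rw [klBlockEquivD_snd_eq]; exact h0 i)]
    congr 2
    · funext i; rw [klBlockEquivD_snd_eq]
    · funext i; rw [klBlockEquivD_snd_eq]
  · rfl

end ReadoutD

end Summit.HubbardSuperconductivity.HubbardSuperconductivity.Theorems.TwoVolumeLip

end
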